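import Literature.NumberTheory.EllipticCurves.ProfiniteGroupDistributionTwoVariableAssembly
import HarnessLib

/-!
# Bounded distributions on a group along a subgroup tower: the INTEGRALS of a glued compatible sequence —
# `∫ f d(glue μ) = ∫ f dμ^{(m)}` for every `f` continuous for the `m`-th tower (de Shalit II.4.14 Step 1)

Topic `NumberTheory/EllipticCurves`; namespace `Literature.NumberTheory.EllipticCurves`.

De Shalit, *Iwasawa theory of elliptic curves with complex multiplication* (1987), II.4.14 Step 1 (p. 71):
"the measures `μ(𝔤𝔭̄^m)` … are compatible, so their inverse limit is a measure `μ` on `𝒢`", used in Steps 2–3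
through its integrals: for a character `ε` of `𝒢 = Gal(K(𝔤p^∞)/K)` factoring through `Gal(K(𝔤𝔭̄^m𝔭^∞)/K)`,
`∫_𝒢 ε dμ = ∫ ε dμ(𝔤𝔭̄^m)`.  `ProfiniteGroupDistributionGlue.lean` defined `glue μ` along the diagonal tower
`V_n = U^{(n)}_n` of a refining sequence of towers `𝒰^{(m)}` from a sequence `μ^{(m)}` compatible under
coarsening (`(id)_* μ^{(m+1)} = μ^{(m)}`).  THIS file computes its integrals:

* `SubgroupTower.U_le_of_le` (`U^{(n)}_k ≤ U^{(m)}_k` for `m ≤ n`), `proj_eq_of_refines`, `diagonal_proj_eq`;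
  `IsTowerContinuous.of_refines` / `.diagonal_of` (continuity for `𝒰^{(m)}` passes to the finer towers and to
  the diagonal);
* `integral_eq_of_compat` — `∫ f dμ^{(n)} = ∫ f dμ^{(m)}` for `m ≤ n` and `f` continuous for `𝒰^{(m)}`
  (`integral_pushforward` along `id`);
* ★★ `integral_glue_eq` — **`∫ f d(glue μ) = ∫ f dμ^{(m)}`** for every `m` and every `𝒰^{(m)}`-continuous `f`.

Everything is a theorem; no named facts, no instances, no `sorry`.

## References

* [deShalit1987] E. de Shalit, *Iwasawa theory of elliptic curves with complex multiplication* (1987),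
  II.4.14 Step 1 (p. 71), I.3.1 (p. 15–16), I.3.8 (16) (p. 20).
* [MazurTateTeitelbaum1986Invent] B. Mazur, J. Tate, J. Teitelbaum, Invent. Math. 84 (1986), §I.11.
-/

noncomputable section

open Filter
open scoped Topology Classical

namespace Literature.NumberTheory.EllipticCurves

variable {G : Type*} [Group G]

/-! ### §1. Refinement along the sequence of towers -/

namespace SubgroupTower

variable (𝒰 : ℕ → SubgroupTower G) (href : ∀ m n, (𝒰 (m + 1)).U n ≤ (𝒰 m).U n)

include href in
/-- `U^{(n)}_k ≤ U^{(m)}_k` for `m ≤ n`. [cite: deShalit1987, II.4.14 Step 1 (p. 71)] -/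
theorem U_le_of_le {m n : ℕ} (h : m ≤ n) (k : ℕ) : (𝒰 n).U k ≤ (𝒰 m).U k := by
  induction n, h using Nat.le_induction with
  | base => exact le_rfl
  | succ n _ ih => exact (href n k).trans ih

include href in
/-- The coarsening hypothesis of `homCellMap id` between `𝒰^{(n)}` and `𝒰^{(m)}`, `m ≤ n`.
[cite: deShalit1987, II.4.14 Step 1 (p. 71)] -/
theorem le_comap_id_of_le {m n : ℕ} (h : m ≤ n) (k : ℕ) : (𝒰 n).U k ≤ ((𝒰 m).U k).comap (MonoidHom.id G) := by
  intro x hx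
  rw [Subgroup.mem_comap, MonoidHom.id_apply]
  exact U_le_of_le 𝒰 href h k hx

include href in
/-- Equal level-`k` cells for `𝒰^{(n)}` give equal level-`k` cells for `𝒰^{(m)}`, `m ≤ n`.
[cite: deShalit1987, II.4.14 Step 1 (p. 71)] -/
theorem proj_eq_of_refines {m n : ℕ} (h : m ≤ n) {k : ℕ} {σ τ : G} (hστ : (𝒰 n).proj k σ = (𝒰 n).proj k τ) :
    (𝒰 m).proj k σ = (𝒰 m).proj k τ :=
  (𝒰 m).proj_eq_iff.mpr (U_le_of_le 𝒰 href h k ((𝒰 n).proj_eq_iff.mp hστ))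

include href in
/-- Equal level-`k` cells of the diagonal tower, `m ≤ k`, give equal level-`k` cells for `𝒰^{(m)}`.
[cite: deShalit1987, II.4.14 Step 1 (p. 71)] -/
theorem diagonal_proj_eq {m k : ℕ} (h : m ≤ k) {σ τ : G} (hστ : (diagonal 𝒰 href).proj k σ = (diagonal 𝒰 href).proj k τ) :
    (𝒰 m).proj k σ = (𝒰 m).proj k τ :=
  (𝒰 m).proj_eq_iff.mpr (U_le_of_le 𝒰 href h k ((diagonal 𝒰 href).proj_eq_iff.mp hστ))

variable {𝒰}

include href in
/-- Tower-continuity for `𝒰^{(m)}` passes to the finer tower `𝒰^{(n)}`, `m ≤ n`. [cite: deShalit1987, I.3.1 (p. 16)] -/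
theorem IsTowerContinuous.of_refines {E : Type*} [PseudoMetricSpace E] {f : G → E} {m n : ℕ} (h : m ≤ n)
    (hf : (𝒰 m).IsTowerContinuous f) : (𝒰 n).IsTowerContinuous f := by
  intro ε hε
  obtain ⟨N, hN⟩ := hf ε hε
  exact ⟨N, fun k hk σ τ hστ ↦ hN k hk σ τ (proj_eq_of_refines 𝒰 href h hστ)⟩

include href in
/-- Tower-continuity for `𝒰^{(m)}` passes to the diagonal tower. [cite: deShalit1987, I.3.1 (p. 16)] -/
theorem IsTowerContinuous.diagonal_of {E : Type*} [PseudoMetricSpace E] {f : G → E} {m : ℕ}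
    (hf : (𝒰 m).IsTowerContinuous f) : (diagonal 𝒰 href).IsTowerContinuous f := by
  intro ε hε
  obtain ⟨N, hN⟩ := hf ε hε
  exact ⟨max N m, fun k hk σ τ hστ ↦ hN k ((le_max_left N m).trans hk) σ τ
    (diagonal_proj_eq 𝒰 href ((le_max_right N m).trans hk) hστ)⟩

end SubgroupTower

/-! ### §2. Integrals along the compatible sequence and of the glued distribution -/

namespace GroupDistribution

variable {𝕜 : Type*} [NormedField 𝕜] [IsUltrametricDist 𝕜] [CompleteSpace 𝕜]
variable {𝒰 : ℕ → SubgroupTower G} {href : ∀ m n, (𝒰 (m + 1)).U n ≤ (𝒰 m).U n}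
  (μ : (m : ℕ) → GroupDistribution (𝒰 m) 𝕜) {C : ℝ} (hC0 : 0 ≤ C) (hC : ∀ m, (μ m).bound ≤ C)
  (hcompat : ∀ m n a, ((μ (m + 1)).pushforward (MonoidHom.id G)
    (SubgroupTower.le_comap_id 𝒰 href m)).μ n a = (μ m).μ n a)

include hcompat in
/-- **`∫ f dμ^{(n)} = ∫ f dμ^{(m)}`** for `m ≤ n` and `f` continuous for `𝒰^{(m)}` (the sequence is compatible
under coarsening and `∫ f d((id)_*μ) = ∫ f dμ`). [cite: deShalit1987, II.4.14 Step 1 (p. 71), I.3.8 (16) (p. 20)] -/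
theorem integral_eq_of_compat {m : ℕ} {f : G → 𝕜} (hf : (𝒰 m).IsTowerContinuous f) :
    ∀ n, m ≤ n → (μ n).integral f = (μ m).integral f := by
  intro n hmn
  induction n, hmn using Nat.le_induction with
  | base => rfl
  | succ n hmn ih =>
    have hfn : (𝒰 n).IsTowerContinuous f := SubgroupTower.IsTowerContinuous.of_refines href hmn hf
    have h1 := (μ (n + 1)).integral_pushforward (MonoidHom.id G) (SubgroupTower.le_comap_id 𝒰 href n) hfn
    have h2 : ((μ (n + 1)).pushforward (MonoidHom.id G) (SubgroupTower.le_comap_id 𝒰 href n)).integral f =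
        (μ n).integral f := integral_congr_of_μ_eq _ _ (hcompat n) f
    rw [← ih, ← h2, h1]
    rfl

include hcompat in
/-- ★★ **The integrals of the glued distribution**: `∫ f d(glue μ) = ∫ f dμ^{(m)}` for every `m` and every `f`
continuous for the `m`-th tower (the level-`n` Riemann sum of `glue μ` is that of `μ^{(n)}`, which is within
`C·ε` of `∫ f dμ^{(n)} = ∫ f dμ^{(m)}`). [cite: deShalit1987, II.4.14 Step 1 (p. 71)]
[cite: MazurTateTeitelbaum1986Invent, §I.11] -/
theorem integral_glue_eq (m : ℕ) {f : G → 𝕜} (hf : (𝒰 m).IsTowerContinuous f) :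
    (glue (href := href) μ hC0 hC hcompat).integral f = (μ m).integral f := by
  have hfd : (SubgroupTower.diagonal 𝒰 href).IsTowerContinuous f :=
    SubgroupTower.IsTowerContinuous.diagonal_of href hf
  refine tendsto_nhds_unique ((glue (href := href) μ hC0 hC hcompat).tendsto_riemannSum_integral hfd) ?_
  refine Metric.tendsto_atTop.mpr fun ε hε ↦ ?_
  have hb : 0 < C + 1 := by linarith
  obtain ⟨N, hN⟩ := hf.exists_forall_norm_sub_le (div_pos hε hb)
  refine ⟨max N m, fun n hn ↦ ?_⟩
  have hNn : N ≤ n := (le_max_left N m).trans hn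
  have hmn : m ≤ n := (le_max_right N m).trans hn
  -- the level-`n` Riemann sum of the glued distribution is that of `μ^{(n)}`
  have hRS : (glue (href := href) μ hC0 hC hcompat).riemannSum f n = (μ n).riemannSum f n := rfl
  -- `μ^{(n)}`'s Riemann sum is within `C · ε/(C+1)` of its integral, which is `∫ f dμ^{(m)}`
  have hN' : ∀ k, N ≤ k → ∀ σ τ : G, (𝒰 n).proj k σ = (𝒰 n).proj k τ → ‖f σ - f τ‖ ≤ ε / (C + 1) :=
    fun k hk σ τ hστ ↦ hN k hk σ τ (SubgroupTower.proj_eq_of_refines 𝒰 href hmn hστ)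
  have h1 := (μ n).norm_integral_sub_riemannSum_le (SubgroupTower.IsTowerContinuous.of_refines href hmn hf)
    (div_pos hε hb).le hN' hNn
  rw [integral_eq_of_compat (href := href) μ hcompat hf n hmn] at h1
  rw [dist_eq_norm, hRS, norm_sub_rev]
  calc ‖(μ m).integral f - (μ n).riemannSum f n‖ ≤ (μ n).bound * (ε / (C + 1)) := h1
    _ ≤ C * (ε / (C + 1)) := by gcongr; exact hC n
    _ < ε := by rw [mul_div_assoc', div_lt_iff₀ hb]; nlinarith

end GroupDistribution

end Literature.NumberTheory.EllipticCurves

end
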